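/-
[OURS · L1 W4.5(b) · EL♮(3)] SPECIMEN-TC⁺ (quartic) — engine extension: the strict transform of the coordinate LINE `V(X₁, X₂)` under a point blow-up.
-/
import Summits.ResolutionOfSingularities.ResolutionOfSingularities.Theorems.EquisingularLiftEquisingularLiftNatSpecimenQuarticTcDeltaEngineClauses
import Summits.ResolutionOfSingularities.ResolutionOfSingularities.Theorems.EquisingularLiftEquisingularLiftNatSpecimenQuarticTcPlusInnerLocalCharts
import Summits.ResolutionOfSingularities.ResolutionOfSingularities.Theorems.EquisingularLiftEquisingularLiftNatSpecimenQuarticTcPlusGammaChartF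
import HarnessLib

/-!
# [OURS · L1 W4.5(b) · EL♮(3)] SPECIMEN-TC⁺ for the quartic — part EL: the (TC)-STEP ENGINE extended to the strict transform of the coordinate
# LINE `V(X₁, X₂) ⊂ U ≅ Spec k[X₀, X₁, X₂]` under a blow-up of `X` at the closed point `x₀`
# (crux `EquisingularLiftNatThree` = stmt-ResolutionOfSingularities-20148; res-L1-w45b-lead-2 DEALS (D2) 2026-08-27T11:55:26Z «NON-VACUITY
# CERTIFICATES TC⁺»; scoping memo D/res-D-pv-034/SPECIMEN-TCPLUS-SCOPE.md §5 (β1); helper, closes nothing)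

HONEST FRAMING. OURS (cell `res-hironaka`, chain w45b, slot W4.5(b)); NOT a statement of any manuscript; AI-written, weaker than expert review.

In the setting of `…TcDeltaEngine` (`b : X′ → X` a blow-up at the closed point `x₀`, `U ∋ x₀` affine with `e : Γ(X,U) ≅ k[X]` carrying `𝓘_{x₀}(U)`
to `(X₀,X₁,X₂)`, charts `c : Spec k[X][𝔪/Xᵢ] → X′`), for a closed `Z ⊆ X` with `𝓘_Z(U) = (e⁻¹X₁, e⁻¹X₂)` (the carrier LINE of the TC⁺ certificate
in the chart centred at the inner point): membership read on a chart (`chart_apply_mem_iff₂`), the strict transform `closure b⁻¹(Z ∖ {x₀})` on a chart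
(`preimage_lineStrictTransform_eq_closure`), EMPTY on the `X₁`- and `X₂`-charts (`preimage_lineStrictTransform_eq_empty₁/₂`) and the line
`V(X₁/X₀, X₂/X₀)` on the `X₀`-chart (`preimage_lineStrictTransform_eq₀`; the prime `(X₁/X₀, X₂/X₀)` with regular quotient:
`isPrime_span_frac₀`, `isRegularRing_quotient_span_frac₀`); `hZ_chart` produces the membership hypothesis from `𝓘_Z · 𝒪 = (X₁, X₂)~`.

References: The Stacks Project, Tags 0804, 080E; Hartshorne II Ex. 3.2.6.
-/

set_option linter.dupNamespace false -- mandated namespace `Summit.<Summit>.<Problem>` of this single-conjunct summit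

noncomputable section

open CategoryTheory CategoryTheory.Limits AlgebraicGeometry TopologicalSpace
open MvPolynomial
open Literature.AlgebraicGeometry.Resolution
open AlgebraicGeometry.Scheme.IdealSheafData
open Summit.ResolutionOfSingularities.ResolutionOfSingularities.Theorems.EquisingularLift

namespace Summit.ResolutionOfSingularities.ResolutionOfSingularities.Cruxes.EquisingularLiftNat.Sections

namespace SpecimenQuarticTcPlus

open SpecimenQuarticTcDelta

universe u

/-! ## The prime `(X₁/X₀, X₂/X₀)` of the `X₀`-chart -/

section Chart0

variable (k : Type) [Field k]

/-- `(X₁/X₀, X₂/X₀) = θ (X₁, X₂)` for the presentation `θ : k[T] ≅ k[X][𝔪/X₀]`, `T₀ ↦ X₀`, `Tⱼ ↦ Xⱼ/X₀`. [folklore] -/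
theorem span_frac₀_eq_map (θ : MvPolynomial (Fin 3) k ≃+* PointBlowup.Chart 2 k 0)
    (h1 : θ (X 1) = PointBlowup.frac 2 k 0 1) (h2 : θ (X 2) = PointBlowup.frac 2 k 0 2) :
    Ideal.span {PointBlowup.frac 2 k 0 1, PointBlowup.frac 2 k 0 2} = (Ideal.span (Set.range (WhitneyCubic.cen k))).map θ.toRingHom := by
  rw [SpecimenQuartic.span_range_cen_eq_pair, Ideal.map_span, Set.image_pair]
  change _ = Ideal.span {θ (X 1), θ (X 2)}
  rw [h1, h2]

/-- **`(X₁/X₀, X₂/X₀) ⊂ k[X][𝔪/X₀]` is prime.** [folklore] -/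
theorem isPrime_span_frac₀ : (Ideal.span {PointBlowup.frac 2 k 0 1, PointBlowup.frac 2 k 0 2}).IsPrime := by
  obtain ⟨θ, -, hθj⟩ := SpecimenQuartic.exists_ringEquiv_pointChart k 0
  rw [span_frac₀_eq_map k θ (hθj 1 (by decide)) (hθj 2 (by decide))]
  haveI := SpecimenQuartic.isPrime_span_cen k
  exact Ideal.map_isPrime_of_equiv θ

/-- `X₀/1 ∉ (X₁/X₀, X₂/X₀)`. [folklore] -/
theorem exc_not_mem_span_frac₀ : PointBlowup.exc 2 k 0 ∉ Ideal.span {PointBlowup.frac 2 k 0 1, PointBlowup.frac 2 k 0 2} := by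
  obtain ⟨θ, hθ0, hθj⟩ := SpecimenQuartic.exists_ringEquiv_pointChart k 0
  rw [span_frac₀_eq_map k θ (hθj 1 (by decide)) (hθj 2 (by decide)), ← hθ0]
  intro h
  apply X_zero_not_mem_span_cen k
  have h' : θ.symm (θ (X 0)) ∈ ((Ideal.span (Set.range (WhitneyCubic.cen k))).map θ.toRingHom).map θ.symm.toRingHom :=
    Ideal.mem_map_of_mem _ h
  rw [θ.symm_apply_apply, Ideal.map_map] at h'
  have hid : θ.symm.toRingHom.comp θ.toRingHom = RingHom.id _ := RingHom.ext fun a => θ.symm_apply_apply a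
  rwa [hid, Ideal.map_id] at h'

/-- **`k[X][𝔪/X₀]/(X₁/X₀, X₂/X₀) ≅ k[T₀]` is a regular ring.** [folklore] -/
theorem isRegularRing_quotient_span_frac₀ :
    IsRegularRing (PointBlowup.Chart 2 k 0 ⧸ Ideal.span {PointBlowup.frac 2 k 0 1, PointBlowup.frac 2 k 0 2}) := by
  obtain ⟨θ, -, hθj⟩ := SpecimenQuartic.exists_ringEquiv_pointChart k 0
  haveI := WhitneyCubic.isRegularRing_quotient_cen k
  exact IsRegularRing.of_ringEquiv (Ideal.quotientEquiv _ _ θ (span_frac₀_eq_map k θ (hθj 1 (by decide)) (hθj 2 (by decide))))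

/-- `(X₁/X₀, X₂/X₀)` is radical. [folklore] -/
theorem radical_span_frac₀ :
    (Ideal.span {PointBlowup.frac 2 k 0 1, PointBlowup.frac 2 k 0 2}).radical = Ideal.span {PointBlowup.frac 2 k 0 1, PointBlowup.frac 2 k 0 2} :=
  (isPrime_span_frac₀ k).radical

end Chart0

/-! ## The strict transform of the coordinate line on the charts -/

/-- `q ∈ V(a, b) ↔ a ∈ q ∧ b ∈ q`. [folklore] -/
theorem mem_zeroLocus_pair_iff {C : Type u} [CommRing C] (q : PrimeSpectrum C) (a b : C) :
    q ∈ PrimeSpectrum.zeroLocus ({a, b} : Set C) ↔ a ∈ q.asIdeal ∧ b ∈ q.asIdeal := by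
  rw [PrimeSpectrum.mem_zeroLocus, Set.insert_subset_iff, Set.singleton_subset_iff, SetLike.mem_coe, SetLike.mem_coe]

section EngineLine

variable {k : Type} [Field k]
variable {X X' : Scheme.{0}} {b : X' ⟶ X} {U : X.affineOpens} {e : Γ(X, U) ≃+* MvPolynomial (Fin 3) k}
  {x₀ : X} (hx₀ : IsClosed ({x₀} : Set X))
variable (hI : ((vanishingIdeal (⟨{x₀}, hx₀⟩ : Closeds X)).ideal U).map e.toRingHom = PointBlowup.originIdeal 2 k)

/-- **On the `i`-th chart, membership in a closed `Z` cut out on `U` by two functions**: if `fromSpec r ∈ Z ↔ e⁻¹g₁, e⁻¹g₂ ∈ r`, then a chart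
point lies over `Z` iff its prime contains `g₁` and `g₂`. [folklore] -/
theorem chart_apply_mem_iff₂ {Z : Set X} {g₁ g₂ : MvPolynomial (Fin 3) k}
    (hZ : ∀ r : Spec Γ(X, U), U.2.fromSpec r ∈ Z ↔ e.symm g₁ ∈ r.asIdeal ∧ e.symm g₂ ∈ r.asIdeal)
    {i : Fin 3} {c : Spec (.of (PointBlowup.Chart 2 k i)) ⟶ X'}
    (hc : c ≫ b = Spec.map (CommRingCat.ofHom (toChartE U e i)) ≫ U.2.fromSpec) (q : Spec (.of (PointBlowup.Chart 2 k i))) :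
    (c ≫ b) q ∈ Z ↔ algebraMap (MvPolynomial (Fin 3) k) (PointBlowup.Chart 2 k i) g₁ ∈ q.asIdeal ∧
      algebraMap (MvPolynomial (Fin 3) k) (PointBlowup.Chart 2 k i) g₂ ∈ q.asIdeal := by
  rw [hc]
  change U.2.fromSpec (Spec.map (CommRingCat.ofHom (toChartE U e i)) q) ∈ Z ↔ _
  rw [hZ, Spec.map_apply]
  change toChartE U e i (e.symm g₁) ∈ q.asIdeal ∧ toChartE U e i (e.symm g₂) ∈ q.asIdeal ↔ _
  rw [toChartE, RingHom.comp_apply, RingHom.comp_apply]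
  change algebraMap _ _ (e (e.symm g₁)) ∈ q.asIdeal ∧ algebraMap _ _ (e (e.symm g₂)) ∈ q.asIdeal ↔ _
  rw [e.apply_symm_apply, e.apply_symm_apply]

include hI in
/-- **The strict transform of `Z` on the chart, first form**: `c⁻¹ closure(b⁻¹(Z ∖ {x₀})) = closure (V(g₁, g₂) ∖ V(Xᵢ/1))`.
[cite: StacksProject, Tag 080E] -/
theorem preimage_lineStrictTransform_eq_closure {Z : Set X} {g₁ g₂ : MvPolynomial (Fin 3) k}
    (hZ : ∀ r : Spec Γ(X, U), U.2.fromSpec r ∈ Z ↔ e.symm g₁ ∈ r.asIdeal ∧ e.symm g₂ ∈ r.asIdeal)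
    {i : Fin 3} {c : Spec (.of (PointBlowup.Chart 2 k i)) ⟶ X'} [IsOpenImmersion c]
    (hc : c ≫ b = Spec.map (CommRingCat.ofHom (toChartE U e i)) ≫ U.2.fromSpec) :
    c ⁻¹' closure (b ⁻¹' (Z \ {x₀})) =
      closure (PrimeSpectrum.zeroLocus {algebraMap (MvPolynomial (Fin 3) k) (PointBlowup.Chart 2 k i) g₁,
          algebraMap (MvPolynomial (Fin 3) k) (PointBlowup.Chart 2 k i) g₂} \
        PrimeSpectrum.zeroLocus {PointBlowup.exc 2 k i}) := by
  rw [c.isOpenEmbedding.isOpenMap.preimage_closure_eq_closure_preimage c.continuous]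
  congr 1
  ext q
  rw [← Set.preimage_comp, ← TopCat.coe_comp, ← Scheme.Hom.comp_base, Set.mem_preimage]
  change (c ≫ b) q ∈ Z ∧ (c ≫ b) q ∉ ({x₀} : Set X) ↔ q ∈ _ ∧ q ∉ _
  rw [Set.mem_singleton_iff, chart_apply_mem_iff₂ hZ hc, chart_apply_eq_iff hx₀ hI hc]
  exact Iff.and (mem_zeroLocus_pair_iff q _ _).symm (Iff.not (mem_zeroLocus_singleton_iff q _).symm)

include hI in
/-- **`X₁`-chart: the strict transform of `V(X₁, X₂)` is EMPTY.** [OURS · SPECIMEN-TC⁺ β1] [folklore] -/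
theorem preimage_lineStrictTransform_eq_empty₁ {Z : Set X}
    (hZ : ∀ r : Spec Γ(X, U), U.2.fromSpec r ∈ Z ↔ e.symm (MvPolynomial.X 1) ∈ r.asIdeal ∧ e.symm (MvPolynomial.X 2) ∈ r.asIdeal)
    {c : Spec (.of (PointBlowup.Chart 2 k 1)) ⟶ X'} [IsOpenImmersion c]
    (hc : c ≫ b = Spec.map (CommRingCat.ofHom (toChartE U e 1)) ≫ U.2.fromSpec) :
    c ⁻¹' closure (b ⁻¹' (Z \ {x₀})) = ∅ := by
  rw [preimage_lineStrictTransform_eq_closure hx₀ hI hZ hc]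
  apply (closure_empty_iff _).mpr
  ext q
  simp only [Set.mem_sdiff, PrimeSpectrum.mem_zeroLocus, Set.insert_subset_iff, Set.singleton_subset_iff, SetLike.mem_coe,
    Set.mem_empty_iff_false, iff_false, not_and, not_not]
  intro h
  exact h.1

include hI in
/-- **`X₂`-chart: the strict transform of `V(X₁, X₂)` is EMPTY.** [OURS · SPECIMEN-TC⁺ β1] [folklore] -/
theorem preimage_lineStrictTransform_eq_empty₂ {Z : Set X}
    (hZ : ∀ r : Spec Γ(X, U), U.2.fromSpec r ∈ Z ↔ e.symm (MvPolynomial.X 1) ∈ r.asIdeal ∧ e.symm (MvPolynomial.X 2) ∈ r.asIdeal)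
    {c : Spec (.of (PointBlowup.Chart 2 k 2)) ⟶ X'} [IsOpenImmersion c]
    (hc : c ≫ b = Spec.map (CommRingCat.ofHom (toChartE U e 2)) ≫ U.2.fromSpec) :
    c ⁻¹' closure (b ⁻¹' (Z \ {x₀})) = ∅ := by
  rw [preimage_lineStrictTransform_eq_closure hx₀ hI hZ hc]
  apply (closure_empty_iff _).mpr
  ext q
  simp only [Set.mem_sdiff, PrimeSpectrum.mem_zeroLocus, Set.insert_subset_iff, Set.singleton_subset_iff, SetLike.mem_coe,
    Set.mem_empty_iff_false, iff_false, not_and, not_not]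
  intro h
  exact h.2

include hI in
/-- **`X₀`-chart: the strict transform of `V(X₁, X₂)` is the LINE `V(X₁/X₀, X₂/X₀)`.** [OURS · SPECIMEN-TC⁺ β1] [cite: StacksProject, Tag 080E] -/
theorem preimage_lineStrictTransform_eq₀ {Z : Set X}
    (hZ : ∀ r : Spec Γ(X, U), U.2.fromSpec r ∈ Z ↔ e.symm (MvPolynomial.X 1) ∈ r.asIdeal ∧ e.symm (MvPolynomial.X 2) ∈ r.asIdeal)
    {c : Spec (.of (PointBlowup.Chart 2 k 0)) ⟶ X'} [IsOpenImmersion c]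
    (hc : c ≫ b = Spec.map (CommRingCat.ofHom (toChartE U e 0)) ≫ U.2.fromSpec) :
    c ⁻¹' closure (b ⁻¹' (Z \ {x₀})) =
      PrimeSpectrum.zeroLocus ((Ideal.span {PointBlowup.frac 2 k 0 1, PointBlowup.frac 2 k 0 2} :
        Ideal (PointBlowup.Chart 2 k 0)) : Set (PointBlowup.Chart 2 k 0)) := by
  rw [preimage_lineStrictTransform_eq_closure hx₀ hI hZ hc, PointBlowup.algebraMap_X 2 k 0 1, PointBlowup.algebraMap_X 2 k 0 2,
    zeroLocus_pair_mul_diff, ← PrimeSpectrum.zeroLocus_span {PointBlowup.frac 2 k 0 1, _}]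
  haveI := isPrime_span_frac₀ k
  exact closure_zeroLocus_diff_eq_of_isPrime _ (exc_not_mem_span_frac₀ k)

end EngineLine

/-! ## From the pull-back `𝓘_Z · 𝒪 = (X₁, X₂)~` on an open-immersion chart to the membership hypothesis -/

section OpenChart

variable {k : Type} [Field k]
variable {Y : Scheme.{0}} (u : Spec (CommRingCat.of (MvPolynomial (Fin 3) k)) ⟶ Y) [IsOpenImmersion u]
variable {Z : Set Y} (hZc : IsClosed Z)
variable (huZ : (vanishingIdeal (⟨Z, hZc⟩ : Closeds Y)).comap u =
    ofIdealTop ((Ideal.span (Set.range (WhitneyCubic.cen k))).map (Scheme.ΓSpecIso (CommRingCat.of (MvPolynomial (Fin 3) k))).inv.hom))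

include huZ in
/-- `hZ`: membership in `Z` over `U = u(Spec k[X])` is vanishing of `e⁻¹X₁` and `e⁻¹X₂`. [folklore] -/
theorem hZ_chart (r : Spec Γ(Y, (chartOpen u : Y.Opens))) :
    (chartOpen u).2.fromSpec r ∈ Z ↔ (chartRingEquiv u).symm (X 1) ∈ r.asIdeal ∧ (chartRingEquiv u).symm (X 2) ∈ r.asIdeal := by
  have h := map_ideal_chartOpen_eq u _ _ huZ
  have hJ : (vanishingIdeal (⟨Z, hZc⟩ : Closeds Y)).ideal (chartOpen u) =
      Ideal.span {(chartRingEquiv u).symm (X 1), (chartRingEquiv u).symm (X 2)} := by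
    have h2 := congrArg (Ideal.map (chartRingEquiv u).symm.toRingHom) h
    rw [Ideal.map_map] at h2
    have hid : (chartRingEquiv u).symm.toRingHom.comp (chartRingEquiv u).toRingHom = RingHom.id _ :=
      RingHom.ext fun a => (chartRingEquiv u).symm_apply_apply a
    rw [hid, Ideal.map_id, SpecimenQuartic.span_range_cen_eq_pair, Ideal.map_span, Set.image_pair] at h2
    exact h2
  rw [fromSpec_mem_iff_ideal_le _ hZc, hJ, Ideal.span_le, Set.insert_subset_iff, Set.singleton_subset_iff]
  rfl

end OpenChart

end SpecimenQuarticTcPlus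

end Summit.ResolutionOfSingularities.ResolutionOfSingularities.Cruxes.EquisingularLiftNat.Sections
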